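import Literature.NumberTheory.GaloisCohomology.Howard2004.DualityDatumLocalCupScalarReadingProofs
import HarnessLib

/-!
# The onto adjoint of the `ℤ/p^k`-reading of Howard's induced local pairing, FLIPPED side — proofs

`Proofs` file (theorems only; no definition, no named fact, no instance, no `sorry`).  Companion of
`DualityDatumLocalCupScalarReadingProofs` §3 (`DualityDatum.exists_forall_reading_localCup_eq`: every character of `H¹(K_v, T)` is
`x ↦ ι_v H²(exp ∘ λ)(x ∪ y)` for some `y ∈ H¹(K_v, Tw T)`).  Here the mirror statement, needed by the `X`-side (towers exchanged,
pairings flipped) of the representability brick `Tower.exists_mem_compatibleFamilies_forall_saturated_pairing_eq_functional` /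
`Tower.exists_sub_pow_smul_forall_pairing_eq_zero` (hypothesis `hsurj` for `B_k.flip`):

* **`DualityDatum.exists_forall_reading_localCup_eq_flip`** — every character `χ : H¹(K_v, Tw T) → ℤ/p^k` is
  `y ↦ ι_v H²(exp ∘ λ)(x ∪ y)` for some `x ∈ H¹(K_v, T)`; same counting (`pairing_reading_surjective_of_injective` applied to the
  flipped reading, both adjoints injective by `injective_localCupZMod[_flip]`).

Cell `pub/bsd-print-x9` (shared μ-crux `MuInequalityCoherentPairOfPrintCG`, STUB A `stub_exactAtP`, (EXACT-REP-INST) `X`-side).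
Conditional on the local invariant maps exactly as the companion file.  BSD is not proved by any of this.

References: [Howard2004HeegnerKolyvagin] §1.3 H.4 (arXiv:1202.6340 p. 7, L69–82), Def. 1.1.1; [MilneADT2006] Ch. I §0 Prop. 0.19,
Cor. 2.3; [Hungerford1974] Ch. IV §4 Ex. 1.
-/

set_option autoImplicit false

noncomputable section

open CategoryTheory Function NumberField IsDedekindDomain Field
open scoped ContRepresentation NumberField

namespace Literature.NumberTheory.GaloisCohomology.Howard2004

open Literature.NumberTheory.GaloisRepresentations
open Literature.NumberTheory.GaloisRepresentations.DiscreteGaloisModule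

variable {K : Type} [Field K] [NumberField K] {M : Type} [AddCommGroup M] [TopologicalSpace M]
  [DiscreteTopology M] {R : Type} [CommRing R] [Module R M] [TopologicalSpace R] [DiscreteTopology R]
  {p : ℕ} [Fact p.Prime] [Algebra ℤ_[p] R] {cd : ConjugationDatum K} {ρ : DiscreteGaloisModule K M}
  (D : DualityDatum p cd ρ R) {k : ℕ}
  (lam : R →+ ZMod (p ^ k))
  (hlam : ∀ (z : ℤ_[p]) (r : R), lam (algebraMap ℤ_[p] R z * r) = PadicInt.toZModPow k z * lam r)
  (exp : ZMod (p ^ k) →+ MuCarrier K (p ^ k))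
  (hexp : ∀ (g : absoluteGaloisGroup K) (x : ZMod (p ^ k)),
    exp (cyclotomicCharacterModPow K p k g * x) = mu K (p ^ k) g (exp x))

namespace DualityDatum

/-- **hsurj, flipped side: every character `χ : H¹(K_v, Tw T) → ℤ/p^k` is `y ↦ ι_v H²(exp ∘ λ)(x ∪ y)` for some `x ∈ H¹(K_v, T)`**
— at a finite place, for `T` finite killed by `p^k`, `Θ` bijective and `ι_v` making both adjoints of the local Tate pairing
injective: both reading adjoints are injective (`injective_localCupZMod[_flip]`), so the flipped adjoint is onto by counting
(`pairing_reading_surjective_of_injective` for the flipped reading). [cite: MilneADT2006, Ch. I §0 Prop. 0.19 and Cor. 2.3]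
[cite: Hungerford1974, Ch. IV §4 Exercise 1] [cite: Howard2004HeegnerKolyvagin, §1.3 H.4 (arXiv p. 7, L78–82)] -/
theorem exists_forall_reading_localCup_eq_flip [Finite M] (hM : ∀ m : M, (p ^ k) • m = 0)
    (hΘ : Bijective (D.toTateDual lam hlam exp hexp)) (v : HeightOneSpectrum (𝓞 K))
    (ι₀ : galoisCohomology ((mu K (p ^ k)).toLocal (Sum.inr v : Place K)) 2 →+ ZMod (p ^ k))
    (hιL : Injective (localTatePairingZMod ρ (p ^ k) (Sum.inr v) ι₀))
    (hιR : Injective (localTatePairingZMod ρ (p ^ k) (Sum.inr v) ι₀).flip)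
    (χ : galoisCohomology ((cd.twist ρ).toLocal (Sum.inr v)) 1 →+ ZMod (p ^ k)) :
    ∃ x : galoisCohomology (ρ.toLocal (Sum.inr v)) 1, ∀ y : galoisCohomology ((cd.twist ρ).toLocal (Sum.inr v)) 1,
      ι₀ (cohomologyMap (D.expLamLocalHom lam hlam exp hexp (Sum.inr v)) 2 (D.localCup (Sum.inr v) x y)) = χ y := by
  haveI : NeZero (p ^ k) := ⟨pow_ne_zero k (Fact.out : p.Prime).ne_zero⟩
  haveI := finite_galoisCohomology_one_toLocal ρ v
  haveI := finite_galoisCohomology_one_toLocal (cd.twist ρ) v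
  have hsurj := Literature.GroupTheory.FiniteAbelian.pairing_reading_surjective_of_injective
    (fun y ↦ galoisCohomology.nsmul_eq_zero_of_forall _ hM y)
    (fun x ↦ galoisCohomology.nsmul_eq_zero_of_forall _ hM x)
    ((localTatePairingZMod ρ (p ^ k) (Sum.inr v) ι₀).compl₂
      (galoisCohomology.map (Literature.NumberTheory.EllipticCurves.DiscreteGaloisModule.localMap
        (D.toTateDual lam hlam exp hexp) (Sum.inr v)) 1)).flip
    (AddMonoidHom.id _)
    (fun x hx ↦ ?_)
    (fun y hy ↦ ?_) χ
  · obtain ⟨x, hx⟩ := hsurj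
    exact ⟨x, fun y ↦ by rw [← hx y, AddMonoidHom.id_apply, AddMonoidHom.flip_apply, D.localCupZMod_apply lam hlam exp hexp]⟩
  · exact (injective_iff_map_eq_zero _).1 (D.injective_localCupZMod lam hlam exp hexp hΘ _ ι₀ hιL) x
      (AddMonoidHom.ext fun y' ↦ hx y')
  · exact (injective_iff_map_eq_zero _).1 (D.injective_localCupZMod_flip lam hlam exp hexp hΘ _ ι₀ hιR) y
      (AddMonoidHom.ext fun x' ↦ hy x')

end DualityDatum

end Literature.NumberTheory.GaloisCohomology.Howard2004

end
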